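import Literature.NumberTheory.LFunctions.ConreyIwaniec2002Corollary63Large
import Literature.NumberTheory.LFunctions.ConreyIwaniec2002WeakCascadeOfProp81
import Literature.NumberTheory.LFunctions.DedekindCloseZeroDoorOfProp81
import HarnessLib

/-!
# Conrey–Iwaniec (2002): the §§9–10 chain from Proposition 8.1 restricted to CLOSE companions

Conrey–Iwaniec, *Spacing of zeros of Hecke L-functions and the class number problem*, Acta Arith.
103 (2002) [held text `paper:arxiv-math_0111012`, p0017–p0020].

The tree derives Proposition 9.1, the principal estimate (9.12) (weak exponent `(log q)^{7/2}`),
Proposition 10.1-weak, Corollary 10.2, Theorem 1.1-weak, `L(1,χ) ≥ (log q)^{−67}`, Corollary 1.3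
(odd, `−19`) and the Dedekind-close-zero door `¼(log q)^{−(4A+19)}` from ONE binder: Proposition 8.1
(8.10) for `1`-spaced `S ⊂ (T,2T]`, `q^65 ≤ T`, `e^{(log q)²} ≤ T`, with UNRESTRICTED companions
`t′ : ℝ → ℝ` (`ConreyIwaniec2002.prop91_large_of_prop81_large`, `corollary102_of_prop81_large`, …).

THIS FILE re-threads the same chain from the binder in the range of the PRINTED PROOF of (8.10):
**companions with `|t′(t) − t| ≤ 1` and `q^66 ≤ T`** (the §8 argument via (7.23) is a
close-companion argument — Lemma 7.4 (7.25) concerns `s′` near `s` — and its sums `A_{13}, A_{23},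
A_{33}` are estimated through Proposition 5.4, whose kernel `K(t/T) ≥ 1` on `[T/2, 3T]` brings in
Proposition 6.4 (6.52) at `T/2`; honest threshold `2q^65`, here `q^66`). NOTHING DOWNSTREAM CHANGES:
* Proposition 9.1 follows from Proposition 8.1 point set by point set and companion map by companion
  map (`prop91_close_of`: the tree's `prop91_large_of'` verbatim with the two hypotheses threaded);
* in the per-segment estimate the points with a FAR companion are trivial:
  `|sinc((t − t′) log t)| ≤ 1/(|t − t′| log t) ≤ 1/log T` (`sincTerm_le_inv_log`), so they contribute
  `≤ 2T/log T ≤ 2·T(log q)^6/log T`; the points with a close companion form a dyadic point set to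
  which the printed argument applies (`perSegmentBound_close_of`, constant `132 + …` for `130 + …`);
* the dyadic union is the tree's (`principalEstimate_close_of` has the conclusion of
  `principalEstimate_of` VERBATIM — companions unrestricted, `T ≥ 2`).
Hence `corollary102_of_prop81_large_close`, `theorem11_weak_of_prop81_large_close`,
`proposition92_weak_of_prop81_large_close`, `proposition92_of_prop81_large_close (hLq)`,
`lOne_ge_log_pow_neg_67_of_prop81_large_close`, `corollary13_odd_weak_of_prop81_large_close`,
`lOne_lowerBound_of_dedekindCloseZero_of_prop81_large_close` — conclusions VERBATIM those of the
`_large` twins. All PROVED; no definition, no named fact introduced.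

«The programme SEARCHES and TYPES; no claim about Landau–Siegel zeros, Theorems 1–2 of
arXiv:2211.02515 or a repaired Margin232 until a kernel theorem says so.»

## References
* [ConreyIwaniec2002] B. Conrey, H. Iwaniec, Acta Arith. 103 (2002) 259–312, arXiv:math/0111012:
  Lemma 7.4 (7.25), Proposition 5.4 (5.18)–(5.19), Proposition 8.1 (8.10), §9 (9.7)–(9.12), §10.
-/

noncomputable section

open scoped NumberField
open Complex

namespace Literature.NumberTheory.LFunctions

namespace ConreyIwaniec2002

open NumberField

/-! ### Proposition 9.1 from Proposition 8.1, close companions, `T ≥ q^66` -/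

/-- **PROPOSITION 9.1 (9.7) for `1`-spaced `S ⊂ (T,2T]`, `q^66 ≤ T`, `e^{(log q)²} ≤ T`, companions
`|t′(t) − t| ≤ 1`, FROM PROPOSITION 8.1 (8.10) in the same range** (Corollary 6.3 in the large range,
Lemma 7.5, the bilinear mean value, the mollifier identity and mean square: all tree theorems).
The proof is the tree's `prop91_large_of'` applied point set by point set: (8.10) is used only for
the given `(S, t′)`. [cite: ConreyIwaniec2002, Proposition 9.1 (9.7), proof p. 20 L1–44] -/
theorem prop91_close_of
    (h81 : ∃ C : ℝ, 0 < C ∧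
      ∀ (q : ℕ) [NeZero q], 4 < q → Odd q → ∀ χ : DirichletCharacter ℂ q,
        χ.IsPrimitive → χ.IsQuadratic → χ.Odd →
          ∀ (K : Type) [Field K] [NumberField K],
            Module.finrank ℚ K = 2 → NumberField.discr K = -(q : ℤ) →
              ∀ (ψ : ClassGroup (𝓞 K) →* ℂˣ) (T : ℝ) (S : Finset ℝ) (t' : ℝ → ℝ),
                (q : ℝ) ^ (66 : ℕ) ≤ T → Real.exp (Real.log q ^ (2 : ℕ)) ≤ T →
                  IsDyadicPointSet S T → (∀ t ∈ S, |t' t - t| ≤ 1) →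
                  defectD K ψ q S t' ≤
                    C * (T * Real.log q ^ (7 : ℕ) + T * calL χ T * Real.log T ^ (4 : ℕ))) :
    ∃ C : ℝ, 0 < C ∧
    ∀ (q : ℕ) [NeZero q], 4 < q → Odd q → ∀ χ : DirichletCharacter ℂ q,
      χ.IsPrimitive → χ.IsQuadratic → χ.Odd →
        ∀ (K : Type) [Field K] [NumberField K],
          Module.finrank ℚ K = 2 → NumberField.discr K = -(q : ℤ) →
            ∀ (ψ : ClassGroup (𝓞 K) →* ℂˣ) (T : ℝ) (S : Finset ℝ) (t' : ℝ → ℝ),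
              (q : ℝ) ^ (66 : ℕ) ≤ T → Real.exp (Real.log q ^ (2 : ℕ)) ≤ T → IsDyadicPointSet S T →
                (∀ t ∈ S, |t' t - t| ≤ 1) →
                defectE K ψ q S t' ≤
                  C * (T * Real.log q ^ (6 : ℕ) +
                    T * Real.sqrt (calL χ T) * Real.log T ^ (2 : ℕ) * Real.log q ^ ((5 : ℝ) / 2)) := by
  obtain ⟨C₁, hC₁, h81⟩ := h81
  obtain ⟨C₅, hC₅, h63⟩ := corollary63_large
  obtain ⟨C₃, hC₃, hx⟩ := norm_xQuot_le
  obtain ⟨C₄, hC₄, hB⟩ := bilinear_hyperbolic_dyadic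
  obtain ⟨C₂, hC₂, hM⟩ := sum_norm_shortInvSum_sq_le
  refine ⟨Real.sqrt (C₁ * C₂) + 15000 * C₃ * C₄ * Real.sqrt C₅, by positivity,
    fun q _ hq hodd χ hprim hquad hoddχ K _ _ h2 hdisc ψ T S t' hT hexpT hS hclose => ?_⟩
  classical
  have hq0 : 0 < q := by omega
  have hqpos : (0 : ℝ) < q := by exact_mod_cast hq0
  have hT65 : (q : ℝ) ^ (65 : ℕ) ≤ T :=
    le_trans (pow_le_pow_right₀ (by exact_mod_cast hq0 : (1 : ℝ) ≤ q) (by norm_num)) hT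
  obtain ⟨hℓ1, hℓLT, hq4T, hq_le_T, hT0, hℓ_le_LT, hLT1⟩ := range_numerics hq hT65 hexpT
  have hT2 : (2 : ℝ) ≤ T := le_trans (by exact_mod_cast (by omega : 2 ≤ q)) hq_le_T
  obtain ⟨hL1q, hcLT, hcLq0, hcLq⟩ :=
    calL_numerics hq χ hq_le_T (norm_LFunction_one_ge q hq χ hprim hquad hoddχ K h2 hdisc)
  obtain ⟨hxpt, hXB⟩ := xQuot_segment_le hC₃ hx hq hT2 hS t' hℓ_le_LT hLT1
  obtain ⟨hA₁, hBn₁, hA₂, hBn₂, hrq⟩ :=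
    coeff_sums_le' hq K ψ
      (fun hn => idealNormCount_eq_norm_divisorSumChar_of_quadratic hprim hquad hoddχ K h2 hdisc hn)
      hC₅ (h63 q hq χ hprim hquad hoddχ)
  -- Proposition 8.1 AT THIS `(S, t′)` and the mollifier mean square
  have hD := h81 q hq hodd χ hprim hquad hoddχ K h2 hdisc ψ T S t' hT hexpT hS hclose
  have hSM := hM q hq hodd χ hprim hquad hoddχ K h2 hdisc ψ T S hq4T hS
  -- the separated bilinear bounds
  have hNT : ((q ^ 4 : ℕ) : ℝ) ≤ T := by push_cast; exact hq4T
  have hq2 : 2 ≤ q ^ 4 := by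
    calc 2 ≤ 2 ^ 4 := by norm_num
      _ ≤ q ^ 4 := Nat.pow_le_pow_left (by omega) 4
  have hlog4 : Real.log ((q ^ 4 : ℕ) : ℝ) = 4 * Real.log q := by
    push_cast; rw [Real.log_pow]; push_cast; ring
  have hSB₁ := hB (q ^ 4) (q ^ 4) (q ^ 2 + 1) (q ^ 4) 1 (q ^ 4)
    (twistMoebius K (classGroupCharIdealHom ψ)) (twistCount K (classGroupCharIdealHom ψ)) T S
    (Nat.le_add_left 1 _) le_rfl le_rfl le_rfl hq2 hT0 hNT hS
  have hSB₂ := hB (q ^ 4) (q ^ 4) 1 (q ^ 2) (q ^ 2 + 1) (q ^ 4)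
    (twistMoebius K (classGroupCharIdealHom ψ)) (twistCount K (classGroupCharIdealHom ψ)) T S
    le_rfl (Nat.pow_le_pow_right hq0 (by norm_num)) (Nat.le_add_left 1 _) le_rfl hq2 hT0 hNT hS
  rw [hlog4] at hSB₁ hSB₂
  -- `E ≤ √D √(Σ|M|²) + X (Σ|B₁| + Σ|B₂|)`
  have hE := defectE_le_diag_offdiag K ψ q S t' (C₃ * (Real.log q + Real.log (2 * T)))
    (fun t => shortInvSum_mul_shortLSum_sub_one K ψ q hq0 (1 / 2 + t * I)) hxpt
  have hSB₁0 : 0 ≤ ∑ t ∈ S, ‖(∑ m ∈ Finset.Icc (q ^ 2 + 1) (q ^ 4), ∑ n ∈ Finset.Icc 1 (q ^ 4),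
            if q ^ 4 < m * n then
              twistMoebius K (classGroupCharIdealHom ψ) m * (m : ℂ) ^ (-(1 / 2 + t * I)) *
                (twistCount K (classGroupCharIdealHom ψ) n * (n : ℂ) ^ (-(1 / 2 + t * I)))
            else 0)‖ := Finset.sum_nonneg fun _ _ => norm_nonneg _
  have hSB₂0 : 0 ≤ ∑ t ∈ S, ‖(∑ m ∈ Finset.Icc 1 (q ^ 2), ∑ n ∈ Finset.Icc (q ^ 2 + 1) (q ^ 4),
            if q ^ 4 < m * n then
              twistMoebius K (classGroupCharIdealHom ψ) m * (m : ℂ) ^ (-(1 / 2 + t * I)) *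
                (twistCount K (classGroupCharIdealHom ψ) n * (n : ℂ) ^ (-(1 / 2 + t * I)))
            else 0)‖ := Finset.sum_nonneg fun _ _ => norm_nonneg _
  -- assemble
  exact prop91_algebra' hC₁ hC₂ hC₃ hC₄ hC₅ hT0.le hℓ1 hℓLT (norm_nonneg _) hqpos hL1q
    (by positivity) hrq hcLq0 hcLq hcLT hE hD hSM hXB hSB₁0 hSB₂0 hSB₁ hSB₂ hA₁ hBn₁ hA₂ hBn₂

/-! ### The per-segment estimate: far companions are trivial -/

/-- **A far companion makes the summand of (9.12) small**: for `t > 1` and `|t′ − t| ≥ 1`,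
`|sinc((t − t′) log t)| ≤ 1/(|t − t′| log t) ≤ 1/log t`.
[cite: ConreyIwaniec2002, §9 (after (9.12))] -/
theorem sincTerm_le_inv_log {t t' : ℝ} (ht : 1 < t) (htt' : 1 ≤ |t' - t|) :
    sincTerm t t' ≤ (Real.log t)⁻¹ := by
  have hlog : 0 < Real.log t := Real.log_pos ht
  have habs : 1 ≤ |t - t'| := by rwa [abs_sub_comm]
  have hx0 : (t - t') * Real.log t ≠ 0 := by
    refine mul_ne_zero ?_ hlog.ne'
    intro h; rw [h, abs_zero] at habs; linarith
  unfold sincTerm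
  rw [Real.sinc_of_ne_zero hx0, abs_div]
  have hden : Real.log t ≤ |(t - t') * Real.log t| := by
    rw [abs_mul, abs_of_pos hlog]
    calc Real.log t = 1 * Real.log t := (one_mul _).symm
      _ ≤ |t - t'| * Real.log t := by gcongr
  have hden0 : 0 < |(t - t') * Real.log t| := abs_pos.mpr hx0
  rw [div_le_iff₀ hden0]
  calc |Real.sin ((t - t') * Real.log t)| ≤ 1 := Real.abs_sin_le_one _
    _ = (Real.log t)⁻¹ * Real.log t := by field_simp
    _ ≤ (Real.log t)⁻¹ * |(t - t') * Real.log t| := by gcongr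

/-- **The per-segment principal estimate from Proposition 9.1 with CLOSE companions** (`T ≥ q^66`,
`log T ≥ (log q)²`, `|t′ − t| ≤ 1`), exponent `e` in (9.11) as in the tree's `perSegmentBound_of`:
for `1`-spaced `S ⊂ (T, 2T]`, `T ≥ 2`, and ANY companion map,
`Σ_{t∈S}|sinc((t−t′)log t)| ≤ C₀(T(log q)^6/log T + T(log T)L(1,χ)^{1/2}(log q)^e + (log q)^{5/2}(TΔ)^{1/2}/log T)`.
The points with `|t′ − t| > 1` contribute `≤ #S/log T ≤ 2T/log T` (`sincTerm_le_inv_log`); the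
others form a dyadic point set with close companions, to which the printed argument
(`perSegment_algebra`) applies with `Δ` and `Σ|M|²` of the whole set; small ranges `T < q^66` or
`log T < (log q)²` are trivial since then `log T < 66 (log q)^6`.
[cite: ConreyIwaniec2002, §9 (9.8)–(9.11)] -/
theorem perSegmentBound_close_of (e : ℝ)
    (h1 : ∃ C : ℝ, 0 < C ∧
      ∀ (q : ℕ) [NeZero q], 4 < q → Odd q → ∀ χ : DirichletCharacter ℂ q,
        χ.IsPrimitive → χ.IsQuadratic → χ.Odd →
          ∀ (K : Type) [Field K] [NumberField K],
            Module.finrank ℚ K = 2 → NumberField.discr K = -(q : ℤ) →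
              ∀ (ψ : ClassGroup (𝓞 K) →* ℂˣ) (T : ℝ) (S : Finset ℝ) (t' : ℝ → ℝ),
                (q : ℝ) ^ (66 : ℕ) ≤ T → Real.exp (Real.log q ^ (2 : ℕ)) ≤ T →
                  IsDyadicPointSet S T → (∀ t ∈ S, |t' t - t| ≤ 1) →
                  defectE K ψ q S t' ≤
                    C * (T * Real.log q ^ (6 : ℕ) +
                      T * Real.sqrt (calL χ T) * Real.log T ^ (2 : ℕ) * Real.log q ^ ((5 : ℝ) / 2)))
    (h4 : ∃ C : ℝ, 0 < C ∧
      ∀ (q : ℕ) [NeZero q], 4 < q → ∀ χ : DirichletCharacter ℂ q,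
        χ.IsPrimitive → χ.IsQuadratic → χ.Odd → ∀ T : ℝ, 2 ≤ T →
          Real.log T * Real.sqrt ‖χ.LFunction 1‖ * Real.log q ^ e ≤ 1 →
            calL χ T ≤ C * (‖χ.LFunction 1‖ * Real.log q ^ (2 * e - 5))) :
    ∃ C : ℝ, 0 < C ∧
    ∀ (q : ℕ) [NeZero q], 4 < q → Odd q → ∀ χ : DirichletCharacter ℂ q,
      χ.IsPrimitive → χ.IsQuadratic → χ.Odd →
        ∀ (K : Type) [Field K] [NumberField K],
          Module.finrank ℚ K = 2 → NumberField.discr K = -(q : ℤ) →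
            ∀ (ψ : ClassGroup (𝓞 K) →* ℂˣ) (T : ℝ) (S : Finset ℝ) (t' : ℝ → ℝ),
              2 ≤ T → IsDyadicPointSet S T →
                ∑ t ∈ S, sincTerm t (t' t) ≤
                  C * (T / Real.log T * Real.log q ^ (6 : ℕ) +
                    T * Real.log T * Real.sqrt ‖χ.LFunction 1‖ * Real.log q ^ e +
                    Real.log q ^ ((5 : ℝ) / 2) / Real.log T *
                      Real.sqrt (T * ∑ t ∈ S, ‖dividedDifference (classGroupLFunction K ψ)
                        (1 / 2 + t * I) (1 / 2 + t' t * I)‖ ^ 2)) := by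
  classical
  obtain ⟨C₁, hC₁, h1⟩ := h1
  obtain ⟨C₂, hC₂, h2⟩ := two_mul_log_mul_sincTerm_le
  obtain ⟨C₃, hC₃, h3⟩ := sum_norm_shortInvSum_sq_le
  obtain ⟨C₄, hC₄, h4⟩ := h4
  have hsC₃ : 0 ≤ Real.sqrt C₃ := Real.sqrt_nonneg _
  have hsC₄ : 0 ≤ Real.sqrt C₄ := Real.sqrt_nonneg _
  have hC₁C₄ : 0 ≤ C₁ * Real.sqrt C₄ := by positivity
  refine ⟨(130 + C₁ + 2 * C₂ + Real.sqrt C₃ + C₁ * Real.sqrt C₄) + 2, by positivity,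
    fun q _ hq hodd χ hprim hquad hoddχ K _ _ hK hdisc ψ T S t' hT hS => ?_⟩
  set C₀ : ℝ := 130 + C₁ + 2 * C₂ + Real.sqrt C₃ + C₁ * Real.sqrt C₄ with hC₀def
  have hC₀130 : (130 : ℝ) ≤ C₀ := by linarith only [hC₀def, hC₁, hC₂, hsC₃, hC₁C₄]
  have hC₀2 : (2 : ℝ) ≤ C₀ := by linarith only [hC₀130]
  -- notation and basic positivity
  have hq5 : (5 : ℝ) ≤ q := by exact_mod_cast hq
  have hℓ1 : 1 < Real.log q := by
    rw [Real.lt_log_iff_exp_lt (by linarith)]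
    exact Real.exp_one_lt_d9.trans_le (by linarith)
  set ℓ : ℝ := Real.log q with hℓdef
  have hℓ0 : 0 < ℓ := by linarith
  have hT0 : 0 < T := by linarith
  set LT : ℝ := Real.log T with hLTdef
  have hLT0 : 0 < LT := Real.log_pos (by linarith)
  set L1 : ℝ := ‖χ.LFunction 1‖ with hL1def
  have hL1 : 0 ≤ L1 := norm_nonneg _
  set Δ : ℝ := ∑ t ∈ S, ‖dividedDifference (classGroupLFunction K ψ)
      (1 / 2 + t * I) (1 / 2 + t' t * I)‖ ^ 2 with hΔdef
  have hΔ0 : 0 ≤ Δ := Finset.sum_nonneg fun _ _ => by positivity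
  have hℓe : 0 < ℓ ^ e := Real.rpow_pos_of_pos hℓ0 e
  have hℓ6 : (1 : ℝ) ≤ ℓ ^ (6 : ℕ) := one_le_pow₀ hℓ1.le
  -- the three terms of (9.12) are non-negative
  have hX₁0 : 0 ≤ T / LT * ℓ ^ (6 : ℕ) := by positivity
  have hX₂0 : 0 ≤ T * LT * Real.sqrt L1 * ℓ ^ e := by positivity
  have hX₃0 : 0 ≤ ℓ ^ ((5 : ℝ) / 2) / LT * Real.sqrt (T * Δ) := by positivity
  set X : ℝ := T / LT * ℓ ^ (6 : ℕ) + T * LT * Real.sqrt L1 * ℓ ^ e +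
      ℓ ^ ((5 : ℝ) / 2) / LT * Real.sqrt (T * Δ) with hXdef
  have hX0 : 0 ≤ X := by positivity
  -- `#S ≤ 2T` and the trivial bound `Σ ≤ #S`
  have hcard : (S.card : ℝ) ≤ 2 * T := (hS.isPointSet hT).card_le' (by linarith)
  have htriv : ∑ t ∈ S, sincTerm t (t' t) ≤ 2 * T := (sum_sincTerm_le_card S t').trans hcard
  -- the far-companion part is always `≤ 2 · (T/LT) ℓ^6`
  have hfar_le : 2 * T / LT ≤ 2 * (T / LT * ℓ ^ (6 : ℕ)) := by
    rw [show 2 * (T / LT * ℓ ^ (6 : ℕ)) = (2 * T / LT) * ℓ ^ (6 : ℕ) by ring]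
    exact le_mul_of_one_le_right (by positivity) hℓ6
  -- Case A: the small ranges `T < q^66` or `log T < (log q)²` are trivial
  by_cases hlarge : (q : ℝ) ^ (66 : ℕ) ≤ T ∧ Real.exp (ℓ ^ (2 : ℕ)) ≤ T
  swap
  · have hlogT : LT < 66 * ℓ ^ (6 : ℕ) := by
      rcases not_and_or.mp hlarge with h66 | hexp
      · push Not at h66
        have h := Real.log_lt_log hT0 h66
        rw [Real.log_pow, Nat.cast_ofNat] at h
        have hℓ6' : ℓ ≤ ℓ ^ (6 : ℕ) := by
          calc ℓ = ℓ ^ 1 := (pow_one ℓ).symm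
            _ ≤ ℓ ^ (6 : ℕ) := pow_le_pow_right₀ hℓ1.le (by norm_num)
        calc LT < 66 * ℓ := h
          _ ≤ 66 * ℓ ^ (6 : ℕ) := by gcongr
      · push Not at hexp
        have h := Real.log_lt_log hT0 hexp
        rw [Real.log_exp] at h
        have hℓ26 : ℓ ^ (2 : ℕ) ≤ ℓ ^ (6 : ℕ) := pow_le_pow_right₀ hℓ1.le (by norm_num)
        have hℓ60 : 0 ≤ ℓ ^ (6 : ℕ) := by positivity
        linarith only [h, hℓ26, hℓ60]
    have hkey : 2 * T ≤ (C₀ + 2) * (T / LT * ℓ ^ (6 : ℕ)) := by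
      rw [show (C₀ + 2) * (T / LT * ℓ ^ (6 : ℕ)) = ((C₀ + 2) * T * ℓ ^ (6 : ℕ)) / LT by ring,
        le_div_iff₀ hLT0]
      calc 2 * T * LT ≤ 2 * T * (66 * ℓ ^ (6 : ℕ)) := by gcongr
        _ = 132 * T * ℓ ^ (6 : ℕ) := by ring
        _ ≤ (C₀ + 2) * T * ℓ ^ (6 : ℕ) := by gcongr; linarith
    calc ∑ t ∈ S, sincTerm t (t' t) ≤ 2 * T := htriv
      _ ≤ (C₀ + 2) * (T / LT * ℓ ^ (6 : ℕ)) := hkey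
      _ ≤ (C₀ + 2) * X := by gcongr; linarith only [hX₂0, hX₃0, hXdef]
  have hLTℓ : ℓ ^ (2 : ℕ) ≤ LT := by
    have h := Real.log_le_log (Real.exp_pos _) hlarge.2
    rwa [Real.log_exp] at h
  have hLT1 : 1 < LT := lt_of_lt_of_le (by nlinarith) hLTℓ
  have hT1 : 1 < T := by linarith
  -- Case B1: the range `(log T) L(1,χ)^{1/2} (log q)^e > 1` is trivial
  by_cases hsmall : LT * Real.sqrt L1 * ℓ ^ e ≤ 1
  swap
  · push Not at hsmall
    have hkey : 2 * T ≤ C₀ * (T * LT * Real.sqrt L1 * ℓ ^ e) := by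
      calc 2 * T = 2 * T * 1 := by ring
        _ ≤ C₀ * T * (LT * Real.sqrt L1 * ℓ ^ e) := by gcongr
        _ = C₀ * (T * LT * Real.sqrt L1 * ℓ ^ e) := by ring
    calc ∑ t ∈ S, sincTerm t (t' t) ≤ 2 * T := htriv
      _ ≤ C₀ * (T * LT * Real.sqrt L1 * ℓ ^ e) := hkey
      _ ≤ C₀ * X := by gcongr; linarith only [hX₁0, hX₃0, hXdef]
      _ ≤ (C₀ + 2) * X := by gcongr; linarith
  -- Case B2: split `S` into close and far companions
  set Sc := S.filter (fun t => |t' t - t| ≤ 1) with hScdef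
  set Sf := S.filter (fun t => ¬ |t' t - t| ≤ 1) with hSfdef
  have hScS : Sc ⊆ S := Finset.filter_subset _ _
  have hSfS : Sf ⊆ S := Finset.filter_subset _ _
  have hsplit : ∑ t ∈ S, sincTerm t (t' t) =
      ∑ t ∈ Sc, sincTerm t (t' t) + ∑ t ∈ Sf, sincTerm t (t' t) :=
    (Finset.sum_filter_add_sum_filter_not S (fun t => |t' t - t| ≤ 1) _).symm
  -- far companions: each term `≤ 1/LT`
  have hfar : ∑ t ∈ Sf, sincTerm t (t' t) ≤ 2 * T / LT := by
    have hpt : ∀ t ∈ Sf, sincTerm t (t' t) ≤ LT⁻¹ := by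
      intro t ht
      rw [hSfdef, Finset.mem_filter] at ht
      have hTt : T < t := (hS.mem_bounds ht.1).1
      have h1t : 1 < t := by linarith
      have hlogt : LT ≤ Real.log t := Real.log_le_log hT0 hTt.le
      calc sincTerm t (t' t) ≤ (Real.log t)⁻¹ := sincTerm_le_inv_log h1t (by linarith [ht.2])
        _ ≤ LT⁻¹ := by
            rw [inv_le_inv₀ (by linarith) hLT0]; exact hlogt
    calc ∑ t ∈ Sf, sincTerm t (t' t) ≤ ∑ t ∈ Sf, LT⁻¹ := Finset.sum_le_sum hpt
      _ = Sf.card * LT⁻¹ := by rw [Finset.sum_const, nsmul_eq_mul]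
      _ ≤ (2 * T) * LT⁻¹ := by
          gcongr
          exact le_trans (by exact_mod_cast Finset.card_le_card hSfS) hcard
      _ = 2 * T / LT := by ring
  -- close companions: the printed argument on the dyadic point set `Sc`
  have hSc : IsDyadicPointSet Sc T := hS.subset hScS
  have hclose : ∀ t ∈ Sc, |t' t - t| ≤ 1 := fun t ht => by
    rw [hScdef, Finset.mem_filter] at ht; exact ht.2
  have hpt : ∀ t ∈ Sc, 2 * LT * sincTerm t (t' t) ≤
      ‖dividedDifference (classGroupLFunction K ψ) (1 / 2 + t * I) (1 / 2 + t' t * I) *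
          starRingEnd ℂ (shortInvSum K ψ q (1 / 2 + t * I)) -
          xQuot q (1 / 2 + t * I) (1 / 2 + t' t * I)‖ +
        ‖dividedDifference (classGroupLFunction K ψ) (1 / 2 + t * I) (1 / 2 + t' t * I)‖ *
          ‖shortInvSum K ψ q (1 / 2 + t * I)‖ + C₂ * ℓ := by
    intro t ht
    have hTt : T < t := (hSc.mem_bounds ht).1
    have hlogt : LT ≤ Real.log t := Real.log_le_log hT0 hTt.le
    have h75 := h2 q hq t (t' t) (by linarith)
    have htri := norm_sub_le
      (dividedDifference (classGroupLFunction K ψ) (1 / 2 + t * I) (1 / 2 + t' t * I) *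
        starRingEnd ℂ (shortInvSum K ψ q (1 / 2 + t * I)))
      (dividedDifference (classGroupLFunction K ψ) (1 / 2 + t * I) (1 / 2 + t' t * I) *
        starRingEnd ℂ (shortInvSum K ψ q (1 / 2 + t * I)) -
        xQuot q (1 / 2 + t * I) (1 / 2 + t' t * I))
    rw [sub_sub_cancel, norm_mul, Complex.norm_conj] at htri
    have hmono : 2 * LT * sincTerm t (t' t) ≤ 2 * Real.log t * sincTerm t (t' t) := by
      have := sincTerm_nonneg t (t' t)
      gcongr
    linarith only [h75, htri, hmono]
  have hsum : 2 * LT * ∑ t ∈ Sc, sincTerm t (t' t) ≤ defectE K ψ q Sc t' +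
      ∑ t ∈ Sc, ‖dividedDifference (classGroupLFunction K ψ) (1 / 2 + t * I) (1 / 2 + t' t * I)‖ *
        ‖shortInvSum K ψ q (1 / 2 + t * I)‖ + C₂ * ℓ * Sc.card := by
    rw [Finset.mul_sum]
    refine (Finset.sum_le_sum hpt).trans (le_of_eq ?_)
    rw [Finset.sum_add_distrib, Finset.sum_add_distrib, Finset.sum_const, nsmul_eq_mul]
    unfold defectE
    ring
  -- Proposition 9.1 on `Sc`, the mean square of `M` on `S`, Cauchy's inequality, (9.11)
  have hE := h1 q hq hodd χ hprim hquad hoddχ K hK hdisc ψ T Sc t' hlarge.1 hlarge.2 hSc hclose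
  have hq4T : (q : ℝ) ^ (4 : ℕ) ≤ T :=
    le_trans (pow_le_pow_right₀ (by linarith) (by norm_num)) hlarge.1
  have hM := h3 q hq hodd χ hprim hquad hoddχ K hK hdisc ψ T S hq4T hS
  have hMc : ∑ t ∈ Sc, ‖shortInvSum K ψ q (1 / 2 + t * I)‖ ^ 2 ≤ C₃ * (T * ℓ ^ (5 : ℕ)) :=
    le_trans (Finset.sum_le_sum_of_subset_of_nonneg hScS fun _ _ _ => by positivity) hM
  have hΔc : ∑ t ∈ Sc, ‖dividedDifference (classGroupLFunction K ψ) (1 / 2 + t * I)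
      (1 / 2 + t' t * I)‖ ^ 2 ≤ Δ :=
    Finset.sum_le_sum_of_subset_of_nonneg hScS fun _ _ _ => by positivity
  have hCS : ∑ t ∈ Sc, ‖dividedDifference (classGroupLFunction K ψ) (1 / 2 + t * I)
      (1 / 2 + t' t * I)‖ * ‖shortInvSum K ψ q (1 / 2 + t * I)‖ ≤
      Real.sqrt Δ * Real.sqrt (C₃ * (T * ℓ ^ (5 : ℕ))) := by
    have hcs := Finset.sum_mul_sq_le_sq_mul_sq Sc
      (fun t => ‖dividedDifference (classGroupLFunction K ψ) (1 / 2 + t * I) (1 / 2 + t' t * I)‖)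
      (fun t => ‖shortInvSum K ψ q (1 / 2 + t * I)‖)
    have h1' := (le_abs_self _).trans (Real.abs_le_sqrt hcs)
    rw [Real.sqrt_mul (Finset.sum_nonneg fun _ _ => by positivity)] at h1'
    refine h1'.trans ?_
    gcongr
  have hcalL : calL χ T ≤ C₄ * (L1 * ℓ ^ (2 * e - 5)) := h4 q hq χ hprim hquad hoddχ T hT hsmall
  have hsq : Real.sqrt (calL χ T) ≤ Real.sqrt C₄ * Real.sqrt L1 * ℓ ^ (e - 5 / 2) := by
    have hW : Real.sqrt (ℓ ^ (2 * e - 5)) = ℓ ^ (e - 5 / 2) := by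
      rw [Real.sqrt_eq_rpow, ← Real.rpow_mul hℓ0.le]
      congr 1
      ring
    rw [← hW, ← Real.sqrt_mul hC₄.le, ← Real.sqrt_mul (by positivity)]
    exact Real.sqrt_le_sqrt (hcalL.trans_eq (by ring))
  have hcardc : (Sc.card : ℝ) ≤ 2 * T :=
    le_trans (by exact_mod_cast Finset.card_le_card hScS) hcard
  have halg := perSegment_algebra hC₁ hC₂ hC₃ hsC₄ (Real.rpow_nonneg hℓ0.le _) hT0 hLT0 hℓ1.le
    hsum hE hCS hsq hcardc
  -- `ℓ^{e−5/2} ℓ^{5/2} = ℓ^e`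
  have hℓpow : ℓ ^ (e - 5 / 2) * ℓ ^ ((5 : ℝ) / 2) = ℓ ^ e := by
    rw [← Real.rpow_add hℓ0]
    congr 1
    ring
  rw [hℓpow] at halg
  -- assemble: close part `≤ C₀ X`, far part `≤ 2 (T/LT) ℓ^6 ≤ 2 X`
  have hfar' : ∑ t ∈ Sf, sincTerm t (t' t) ≤ 2 * X := by
    refine hfar.trans (hfar_le.trans ?_)
    linarith only [hX₂0, hX₃0, hXdef]
  rw [hsplit]
  calc ∑ t ∈ Sc, sincTerm t (t' t) + ∑ t ∈ Sf, sincTerm t (t' t) ≤ C₀ * X + 2 * X :=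
        add_le_add halg hfar'
    _ = (C₀ + 2) * X := by ring

/-! ### The dyadic union: the principal estimate from Proposition 9.1 with close companions -/

/-- **The principal estimate with exponent `e` from the per-segment form with CLOSE companions**,
by the tree's dyadic union — conclusion VERBATIM that of `principalEstimate_of` (companions
unrestricted, `T ≥ 2`). [cite: ConreyIwaniec2002, §9 (before Proposition 9.2)] -/
theorem principalEstimate_close_of (e : ℝ)
    (h1 : ∃ C : ℝ, 0 < C ∧
      ∀ (q : ℕ) [NeZero q], 4 < q → Odd q → ∀ χ : DirichletCharacter ℂ q,
        χ.IsPrimitive → χ.IsQuadratic → χ.Odd →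
          ∀ (K : Type) [Field K] [NumberField K],
            Module.finrank ℚ K = 2 → NumberField.discr K = -(q : ℤ) →
              ∀ (ψ : ClassGroup (𝓞 K) →* ℂˣ) (T : ℝ) (S : Finset ℝ) (t' : ℝ → ℝ),
                (q : ℝ) ^ (66 : ℕ) ≤ T → Real.exp (Real.log q ^ (2 : ℕ)) ≤ T →
                  IsDyadicPointSet S T → (∀ t ∈ S, |t' t - t| ≤ 1) →
                  defectE K ψ q S t' ≤
                    C * (T * Real.log q ^ (6 : ℕ) +
                      T * Real.sqrt (calL χ T) * Real.log T ^ (2 : ℕ) * Real.log q ^ ((5 : ℝ) / 2)))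
    (h4 : ∃ C : ℝ, 0 < C ∧
      ∀ (q : ℕ) [NeZero q], 4 < q → ∀ χ : DirichletCharacter ℂ q,
        χ.IsPrimitive → χ.IsQuadratic → χ.Odd → ∀ T : ℝ, 2 ≤ T →
          Real.log T * Real.sqrt ‖χ.LFunction 1‖ * Real.log q ^ e ≤ 1 →
            calL χ T ≤ C * (‖χ.LFunction 1‖ * Real.log q ^ (2 * e - 5))) :
    ∃ C : ℝ, 0 < C ∧
    ∀ (q : ℕ) [NeZero q], 4 < q → Odd q → ∀ χ : DirichletCharacter ℂ q,
      χ.IsPrimitive → χ.IsQuadratic → χ.Odd →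
        ∀ (K : Type) [Field K] [NumberField K],
          Module.finrank ℚ K = 2 → NumberField.discr K = -(q : ℤ) →
            ∀ (ψ : ClassGroup (𝓞 K) →* ℂˣ) (T : ℝ) (S : Finset ℝ) (t' : ℝ → ℝ),
              2 ≤ T → IsPointSet S T →
                ∑ t ∈ S, sincTerm t (t' t) ≤
                  C * (T / Real.log T * Real.log q ^ (6 : ℕ) +
                    T * Real.log T * Real.sqrt ‖χ.LFunction 1‖ * Real.log q ^ e +
                    Real.log q ^ ((5 : ℝ) / 2) / Real.log T *
                      Real.sqrt (T * ∑ t ∈ S, ‖dividedDifference (classGroupLFunction K ψ)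
                        (1 / 2 + t * I) (1 / 2 + t' t * I)‖ ^ 2)) := by
  classical
  obtain ⟨C₀, hC₀, hseg⟩ := perSegmentBound_close_of e h1 h4
  obtain ⟨C', hC', h⟩ := dyadic_union C₀ hC₀
  refine ⟨C', hC', fun q _ hq hodd χ hprim hquad hoddχ K _ _ hK hdisc ψ T S t' hT hS => ?_⟩
  have hq5 : (5 : ℝ) ≤ q := by exact_mod_cast hq
  have hℓ1 : 1 < Real.log q := by
    rw [Real.lt_log_iff_exp_lt (by linarith)]
    exact Real.exp_one_lt_d9.trans_le (by linarith)
  have hA : (1 : ℝ) ≤ Real.log q ^ (6 : ℕ) := one_le_pow₀ hℓ1.le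
  have hB : (0 : ℝ) ≤ Real.sqrt ‖χ.LFunction 1‖ * Real.log q ^ e := by
    have := Real.rpow_nonneg (by linarith : (0 : ℝ) ≤ Real.log q) e
    positivity
  have hE : (0 : ℝ) ≤ Real.log q ^ ((5 : ℝ) / 2) := by positivity
  have key := h (Real.log q ^ (6 : ℕ)) (Real.sqrt ‖χ.LFunction 1‖ * Real.log q ^ e)
    (Real.log q ^ ((5 : ℝ) / 2)) T S (fun t => sincTerm t (t' t))
    (fun t => ‖dividedDifference (classGroupLFunction K ψ) (1 / 2 + t * I) (1 / 2 + t' t * I)‖ ^ 2)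
    hA hB hE hT hS (fun t => sincTerm_nonneg t (t' t)) (fun t => sincTerm_le_one t (t' t))
    (fun t => by positivity)
    (fun T₀ S₀ hT₀ _ hS₀ => by
      have := hseg q hq hodd χ hprim hquad hoddχ K hK hdisc ψ T₀ S₀ t' hT₀ hS₀
      convert this using 2
      ring)
  convert key using 2
  ring

/-! ### Down the chain, from Proposition 8.1 with close companions alone -/

/-- **PROPOSITION 9.2 WITH `(log q)^{7/2}` (fact-free in (9.11)) FROM PROPOSITION 8.1 (`_large_close`).**
Conclusion VERBATIM that of `conreyIwaniec2002_proposition92_weak_of_proposition81`.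
[cite: ConreyIwaniec2002, Proposition 9.2 (9.12)] -/
theorem proposition92_weak_of_prop81_large_close
    (h81 : ∃ C : ℝ, 0 < C ∧
      ∀ (q : ℕ) [NeZero q], 4 < q → Odd q → ∀ χ : DirichletCharacter ℂ q,
        χ.IsPrimitive → χ.IsQuadratic → χ.Odd →
          ∀ (K : Type) [Field K] [NumberField K],
            Module.finrank ℚ K = 2 → NumberField.discr K = -(q : ℤ) →
              ∀ (ψ : ClassGroup (𝓞 K) →* ℂˣ) (T : ℝ) (S : Finset ℝ) (t' : ℝ → ℝ),
                (q : ℝ) ^ (66 : ℕ) ≤ T → Real.exp (Real.log q ^ (2 : ℕ)) ≤ T →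
                  IsDyadicPointSet S T → (∀ t ∈ S, |t' t - t| ≤ 1) →
                  defectD K ψ q S t' ≤
                    C * (T * Real.log q ^ (7 : ℕ) + T * calL χ T * Real.log T ^ (4 : ℕ))) :
    ∃ C : ℝ, 0 < C ∧
    ∀ (q : ℕ) [NeZero q], 4 < q → Odd q → ∀ χ : DirichletCharacter ℂ q,
      χ.IsPrimitive → χ.IsQuadratic → χ.Odd →
        ∀ (K : Type) [Field K] [NumberField K],
          Module.finrank ℚ K = 2 → NumberField.discr K = -(q : ℤ) →
            ∀ (ψ : ClassGroup (𝓞 K) →* ℂˣ) (T : ℝ) (S : Finset ℝ) (t' : ℝ → ℝ),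
              2 ≤ T → IsPointSet S T →
                ∑ t ∈ S, sincTerm t (t' t) ≤
                  C * (T / Real.log T * Real.log q ^ (6 : ℕ) +
                    T * Real.log T * Real.sqrt ‖χ.LFunction 1‖ * Real.log q ^ ((7 : ℝ) / 2) +
                    Real.log q ^ ((5 : ℝ) / 2) / Real.log T *
                      Real.sqrt (T * ∑ t ∈ S, ‖dividedDifference (classGroupLFunction K ψ)
                        (1 / 2 + t * I) (1 / 2 + t' t * I)‖ ^ 2)) :=
  principalEstimate_close_of ((7 : ℝ) / 2) (prop91_close_of h81) calL_le_of_small_weak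

/-- **PROPOSITION 9.2 AS TYPED (BY NAME) FROM PROPOSITION 8.1 (`_large_close`), given the printed
(9.11) claim `hLq`** (HONEST LABEL as in `conreyIwaniec2002_proposition92_of_proposition91`:
`|L′(1,χ)| ≪ log q` in the exceptional regime, open). [cite: ConreyIwaniec2002, Proposition 9.2 (9.12)] -/
theorem proposition92_of_prop81_large_close
    (h81 : ∃ C : ℝ, 0 < C ∧
      ∀ (q : ℕ) [NeZero q], 4 < q → Odd q → ∀ χ : DirichletCharacter ℂ q,
        χ.IsPrimitive → χ.IsQuadratic → χ.Odd →
          ∀ (K : Type) [Field K] [NumberField K],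
            Module.finrank ℚ K = 2 → NumberField.discr K = -(q : ℤ) →
              ∀ (ψ : ClassGroup (𝓞 K) →* ℂˣ) (T : ℝ) (S : Finset ℝ) (t' : ℝ → ℝ),
                (q : ℝ) ^ (66 : ℕ) ≤ T → Real.exp (Real.log q ^ (2 : ℕ)) ≤ T →
                  IsDyadicPointSet S T → (∀ t ∈ S, |t' t - t| ≤ 1) →
                  defectD K ψ q S t' ≤
                    C * (T * Real.log q ^ (7 : ℕ) + T * calL χ T * Real.log T ^ (4 : ℕ)))
    (hLq : ∃ C : ℝ, 0 < C ∧
      ∀ (q : ℕ) [NeZero q], 4 < q → ∀ χ : DirichletCharacter ℂ q,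
        χ.IsPrimitive → χ.IsQuadratic → χ.Odd → ∀ T : ℝ, 2 ≤ T →
          Real.log T * Real.sqrt ‖χ.LFunction 1‖ * Real.log q ^ (3 : ℕ) ≤ 1 →
            calL χ T ≤ C * (‖χ.LFunction 1‖ * Real.log q)) :
    conreyIwaniec2002_proposition92 := by
  have h4 : ∃ C : ℝ, 0 < C ∧
      ∀ (q : ℕ) [NeZero q], 4 < q → ∀ χ : DirichletCharacter ℂ q,
        χ.IsPrimitive → χ.IsQuadratic → χ.Odd → ∀ T : ℝ, 2 ≤ T →
          Real.log T * Real.sqrt ‖χ.LFunction 1‖ * Real.log q ^ (3 : ℝ) ≤ 1 →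
            calL χ T ≤ C * (‖χ.LFunction 1‖ * Real.log q ^ (2 * (3 : ℝ) - 5)) := by
    obtain ⟨C, hC, h⟩ := hLq
    refine ⟨C, hC, fun q _ hq χ hprim hquad hodd T hT hsm => ?_⟩
    have e3 : Real.log q ^ (3 : ℝ) = Real.log q ^ (3 : ℕ) := by
      rw [← Real.rpow_natCast]; norm_num
    have e1 : Real.log q ^ (2 * (3 : ℝ) - 5) = Real.log q := by norm_num
    rw [e1]
    rw [e3] at hsm
    exact h q hq χ hprim hquad hodd T hT hsm
  obtain ⟨C, hC, h⟩ := principalEstimate_close_of 3 (prop91_close_of h81) h4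
  refine ⟨C, hC, fun q _ hq hodd χ hprim hquad hoddχ K _ _ hK hdisc ψ T S t' hT hS => ?_⟩
  have := h q hq hodd χ hprim hquad hoddχ K hK hdisc ψ T S t' hT hS
  have e3 : Real.log q ^ (3 : ℝ) = Real.log q ^ (3 : ℕ) := by
    rw [← Real.rpow_natCast]; norm_num
  rw [e3] at this
  exact this

/-- **COROLLARY 10.2 (Theorem 1.2 for odd `q`, exponent `−90`) FROM PROPOSITION 8.1 (`_large_close`).**
[cite: ConreyIwaniec2002, Corollary 10.2] -/
theorem corollary102_of_prop81_large_close
    (h81 : ∃ C : ℝ, 0 < C ∧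
      ∀ (q : ℕ) [NeZero q], 4 < q → Odd q → ∀ χ : DirichletCharacter ℂ q,
        χ.IsPrimitive → χ.IsQuadratic → χ.Odd →
          ∀ (K : Type) [Field K] [NumberField K],
            Module.finrank ℚ K = 2 → NumberField.discr K = -(q : ℤ) →
              ∀ (ψ : ClassGroup (𝓞 K) →* ℂˣ) (T : ℝ) (S : Finset ℝ) (t' : ℝ → ℝ),
                (q : ℝ) ^ (66 : ℕ) ≤ T → Real.exp (Real.log q ^ (2 : ℕ)) ≤ T →
                  IsDyadicPointSet S T → (∀ t ∈ S, |t' t - t| ≤ 1) →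
                  defectD K ψ q S t' ≤
                    C * (T * Real.log q ^ (7 : ℕ) + T * calL χ T * Real.log T ^ (4 : ℕ))) :
    conreyIwaniec2002_corollary102 :=
  corollary102_of_proposition101_weak
    (proposition101_weak_of_principalEstimate_weak (proposition92_weak_of_prop81_large_close h81))

/-- **THEOREM 1.1-WEAK (odd `q`, exponent `−(2A+7)`) FROM PROPOSITION 8.1 (`_large_close`).**
[cite: ConreyIwaniec2002, Theorem 1.1] -/
theorem theorem11_weak_of_prop81_large_close
    (h81 : ∃ C : ℝ, 0 < C ∧
      ∀ (q : ℕ) [NeZero q], 4 < q → Odd q → ∀ χ : DirichletCharacter ℂ q,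
        χ.IsPrimitive → χ.IsQuadratic → χ.Odd →
          ∀ (K : Type) [Field K] [NumberField K],
            Module.finrank ℚ K = 2 → NumberField.discr K = -(q : ℤ) →
              ∀ (ψ : ClassGroup (𝓞 K) →* ℂˣ) (T : ℝ) (S : Finset ℝ) (t' : ℝ → ℝ),
                (q : ℝ) ^ (66 : ℕ) ≤ T → Real.exp (Real.log q ^ (2 : ℕ)) ≤ T →
                  IsDyadicPointSet S T → (∀ t ∈ S, |t' t - t| ≤ 1) →
                  defectD K ψ q S t' ≤
                    C * (T * Real.log q ^ (7 : ℕ) + T * calL χ T * Real.log T ^ (4 : ℕ))) :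
    conreyIwaniec2002_theorem11_weak :=
  theorem11_weak_of_proposition101_weak
    (proposition101_weak_of_principalEstimate_weak (proposition92_weak_of_prop81_large_close h81))

/-- **`L(1,χ) ≥ (log q)^{−67}` FROM PROPOSITION 8.1 (`_large_close`)** (conclusion VERBATIM that of
`lOne_ge_log_pow_neg_67_of_prop81_large`). [cite: ConreyIwaniec2002, Theorem 1.1 (remark after (1.21))] -/
theorem lOne_ge_log_pow_neg_67_of_prop81_large_close
    (h81 : ∃ C : ℝ, 0 < C ∧
      ∀ (q : ℕ) [NeZero q], 4 < q → Odd q → ∀ χ : DirichletCharacter ℂ q,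
        χ.IsPrimitive → χ.IsQuadratic → χ.Odd →
          ∀ (K : Type) [Field K] [NumberField K],
            Module.finrank ℚ K = 2 → NumberField.discr K = -(q : ℤ) →
              ∀ (ψ : ClassGroup (𝓞 K) →* ℂˣ) (T : ℝ) (S : Finset ℝ) (t' : ℝ → ℝ),
                (q : ℝ) ^ (66 : ℕ) ≤ T → Real.exp (Real.log q ^ (2 : ℕ)) ≤ T →
                  IsDyadicPointSet S T → (∀ t ∈ S, |t' t - t| ≤ 1) →
                  defectD K ψ q S t' ≤
                    C * (T * Real.log q ^ (7 : ℕ) + T * calL χ T * Real.log T ^ (4 : ℕ))) :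
    ∃ c : ℝ, 0 < c ∧
      ∀ (q : ℕ) [NeZero q], 4 < q → Odd q → ∀ χ : DirichletCharacter ℂ q,
        χ.IsPrimitive → χ.IsQuadratic → χ.Odd →
          ∀ (K : Type) [Field K] [NumberField K],
            Module.finrank ℚ K = 2 → NumberField.discr K = -(q : ℤ) →
              ∀ (ψ : ClassGroup (𝓞 K) →* ℂˣ) (T α : ℝ), 2 ≤ T → 0 < α → α ≤ 1 →
                Real.log T = Real.log q ^ (18 : ℝ) →
                  α⁻¹ * c * T * Real.log T ^ ((1 : ℝ) / 3) ≤
                      (closeZeroCount (classGroupLFunction K ψ) α T : ℝ) →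
                    Real.log q ^ (-(67 : ℝ)) ≤ ‖χ.LFunction 1‖ :=
  lOne_ge_log_pow_neg_67_of_theorem11_weak (theorem11_weak_of_prop81_large_close h81)

/-- **COROLLARY 1.3 FOR ODD `q` WITH `c′ (log q)^{−19}` FROM PROPOSITION 8.1 (`_large_close`)**
(conclusion VERBATIM that of `corollary13_odd_weak_of_prop81_large`). [cite: ConreyIwaniec2002, Corollary 1.3] -/
theorem corollary13_odd_weak_of_prop81_large_close
    (h81 : ∃ C : ℝ, 0 < C ∧
      ∀ (q : ℕ) [NeZero q], 4 < q → Odd q → ∀ χ : DirichletCharacter ℂ q,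
        χ.IsPrimitive → χ.IsQuadratic → χ.Odd →
          ∀ (K : Type) [Field K] [NumberField K],
            Module.finrank ℚ K = 2 → NumberField.discr K = -(q : ℤ) →
              ∀ (ψ : ClassGroup (𝓞 K) →* ℂˣ) (T : ℝ) (S : Finset ℝ) (t' : ℝ → ℝ),
                (q : ℝ) ^ (66 : ℕ) ≤ T → Real.exp (Real.log q ^ (2 : ℕ)) ≤ T →
                  IsDyadicPointSet S T → (∀ t ∈ S, |t' t - t| ≤ 1) →
                  defectD K ψ q S t' ≤
                    C * (T * Real.log q ^ (7 : ℕ) + T * calL χ T * Real.log T ^ (4 : ℕ))) :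
    ∃ c₁ : ℝ, 0 < c₁ ∧ ∃ c' : ℝ, 0 < c' ∧
      ∀ (q : ℕ) [NeZero q], 4 < q → Odd q → ∀ χ : DirichletCharacter ℂ q,
        χ.IsPrimitive → χ.IsQuadratic → χ.Odd →
          ∀ (K : Type) [Field K] [NumberField K],
            Module.finrank ℚ K = 2 → NumberField.discr K = -(q : ℤ) →
              ∀ (ψ : ClassGroup (𝓞 K) →* ℂˣ) (S : Finset ℝ),
                IsPointSet S (Real.exp (Real.log q ^ (6 : ℕ))) →
                  (∀ t ∈ S, ‖deriv (classGroupLFunction K ψ) (1 / 2 + t * I)‖ ≤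
                      Real.log q ^ ((7 : ℝ) / 2)) →
                    c₁ * Real.exp (Real.log q ^ (6 : ℕ)) ≤ (S.card : ℝ) →
                      c' * Real.log q ^ (-(19 : ℝ)) ≤ ‖χ.LFunction 1‖ :=
  corollary13_odd_weak_of_proposition101_weak
    (proposition101_weak_of_principalEstimate_weak (proposition92_weak_of_prop81_large_close h81))

/-- **THE DEDEKIND-CLOSE-ZERO DOOR FROM PROPOSITION 8.1 (`_large_close`)**: `H_K(A, α)` and (8.10)
in the range of its printed proof give `L(1,χ) ≥ ¼ (log q)^{−(4A+19)}` for all large odd `q`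
(conclusion VERBATIM that of `lOne_lowerBound_of_dedekindCloseZero_of_prop81_large`).
[cite: ConreyIwaniec2002, Theorem 1.1 (1.21)] -/
theorem lOne_lowerBound_of_dedekindCloseZero_of_prop81_large_close {A α : ℝ} (hA : 0 ≤ A)
    (hα : 0 < α) (hα1 : α ≤ 1)
    (h81 : ∃ C : ℝ, 0 < C ∧
      ∀ (q : ℕ) [NeZero q], 4 < q → Odd q → ∀ χ : DirichletCharacter ℂ q,
        χ.IsPrimitive → χ.IsQuadratic → χ.Odd →
          ∀ (K : Type) [Field K] [NumberField K],
            Module.finrank ℚ K = 2 → NumberField.discr K = -(q : ℤ) →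
              ∀ (ψ : ClassGroup (𝓞 K) →* ℂˣ) (T : ℝ) (S : Finset ℝ) (t' : ℝ → ℝ),
                (q : ℝ) ^ (66 : ℕ) ≤ T → Real.exp (Real.log q ^ (2 : ℕ)) ≤ T →
                  IsDyadicPointSet S T → (∀ t ∈ S, |t' t - t| ≤ 1) →
                  defectD K ψ q S t' ≤
                    C * (T * Real.log q ^ (7 : ℕ) + T * calL χ T * Real.log T ^ (4 : ℕ)))
    (h : DedekindCloseZeroHypothesis A α) :
    ∃ q₀ : ℕ, ∀ (q : ℕ) [NeZero q], q₀ ≤ q → 4 < q → Odd q →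
      ∀ χ : DirichletCharacter ℂ q, χ.IsPrimitive → χ.IsQuadratic → χ.Odd →
        ∀ (K : Type) [Field K] [NumberField K],
          Module.finrank ℚ K = 2 → NumberField.discr K = -(q : ℤ) →
            (1 / 4) * Real.log q ^ (-(4 * A + 19)) ≤ ‖χ.LFunction 1‖ :=
  lOne_lowerBound_of_dedekindCloseZero_weak hA hα hα1 (theorem11_weak_of_prop81_large_close h81) h

/-- **The `_large` binder of record implies the `_large_close` binder** (fewer companions, smaller
range): nothing proved from Proposition 8.1 (`_large`) is lost by switching to the close form.
[cite: ConreyIwaniec2002, Proposition 8.1 (8.10)] -/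
theorem prop81_large_close_of_prop81_large
    (h81 : ∃ C : ℝ, 0 < C ∧
      ∀ (q : ℕ) [NeZero q], 4 < q → Odd q → ∀ χ : DirichletCharacter ℂ q,
        χ.IsPrimitive → χ.IsQuadratic → χ.Odd →
          ∀ (K : Type) [Field K] [NumberField K],
            Module.finrank ℚ K = 2 → NumberField.discr K = -(q : ℤ) →
              ∀ (ψ : ClassGroup (𝓞 K) →* ℂˣ) (T : ℝ) (S : Finset ℝ) (t' : ℝ → ℝ),
                (q : ℝ) ^ (65 : ℕ) ≤ T → Real.exp (Real.log q ^ (2 : ℕ)) ≤ T →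
                  IsDyadicPointSet S T →
                  defectD K ψ q S t' ≤
                    C * (T * Real.log q ^ (7 : ℕ) + T * calL χ T * Real.log T ^ (4 : ℕ))) :
    ∃ C : ℝ, 0 < C ∧
      ∀ (q : ℕ) [NeZero q], 4 < q → Odd q → ∀ χ : DirichletCharacter ℂ q,
        χ.IsPrimitive → χ.IsQuadratic → χ.Odd →
          ∀ (K : Type) [Field K] [NumberField K],
            Module.finrank ℚ K = 2 → NumberField.discr K = -(q : ℤ) →
              ∀ (ψ : ClassGroup (𝓞 K) →* ℂˣ) (T : ℝ) (S : Finset ℝ) (t' : ℝ → ℝ),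
                (q : ℝ) ^ (66 : ℕ) ≤ T → Real.exp (Real.log q ^ (2 : ℕ)) ≤ T →
                  IsDyadicPointSet S T → (∀ t ∈ S, |t' t - t| ≤ 1) →
                  defectD K ψ q S t' ≤
                    C * (T * Real.log q ^ (7 : ℕ) + T * calL χ T * Real.log T ^ (4 : ℕ)) := by
  obtain ⟨C, hC, h⟩ := h81
  refine ⟨C, hC, fun q _ hq hodd χ hprim hquad hoddχ K _ _ hK hdisc ψ T S t' hT hexpT hS _ => ?_⟩
  have hq0 : 0 < q := by omega
  have hT65 : (q : ℝ) ^ (65 : ℕ) ≤ T :=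
    le_trans (pow_le_pow_right₀ (by exact_mod_cast hq0 : (1 : ℝ) ≤ q) (by norm_num)) hT
  exact h q hq hodd χ hprim hquad hoddχ K hK hdisc ψ T S t' hT65 hexpT hS

end ConreyIwaniec2002

end Literature.NumberTheory.LFunctions

end
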